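import Literature.MathematicalPhysics.QuantumFieldTheory.Balaban1983to89.B12Eq311LatticeBounds

/-!
# `Balaban1983to89.B12Eq311RemainderBound` — [Balaban1987RG1] (3.11)–(3.14) p. 272 by the route [Balaban1985RegularSpaces] (1.54):
# file 4 of 4 — THE BOUND ON THE REMAINDER 𝐅(U, 𝐀) OF (3.11) («𝐅 is a local operator depending on U, ∂U, 𝐀, ∇^ξ_U𝐀 only»), its linear
# B12-units form `‖𝐅‖ ≤ (d − 1)·Cπ·C_F(ρ)·α₂`, and the same in the letters of the spaces (1.11)–(1.14) on the torus

statement-level skeleton of published theorems with citation tags; proofs where landed; nothing here is a claim about the Yang–Mills mass gap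

Cell `lit-balaban`, unit `lit-balaban-p07` (Phase-2 proof seat p07 gen 7); SKELETON row `B12.Eq3.10-3.12`; HOME
`run/shared/lean/pub/lit-balaban/`.  See the header of `B12Eq311CurrentExpansion` (file 1) for the printed texts, the carriers and the
HONEST SCOPE; this file is theorems only.

THIS FILE.  §1 **`norm_F311_le`** — [14] (1.54) «the basic estimate» for the current (1.8) with `π`, general background:
`‖𝐅(U, 𝐀)(b)‖ ≤ (d − 1)·[ξ⁻¹(e^{2ξρ²a} − 1)ρ²𝔊 + ξ⁻³(B_q + B_r)]`, every constant explicit (`𝔊 = Cπ½(1 + (e^{ξa}ρ)⁴)Π₁`,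
`B_q = Cπξ³(1 + ρ²)(3ρ² + 1)s̄g`, `B_r = (ρ² + 1)Cπ[(ξs̄)³/6·e^{ξs̄} + (e^{ξs̄} − 1)e^{ξs̄}(1 + ρ⁴)ε]`), from `F311_split` (file 1) and the
three directional bounds (file 3) through the counting bound (file 2).  §2 `termI_le`, `termQ_le`, `termR_le` and
**`norm_F311_le_linear`**: in B12 units (`0 < ξ ≤ 1`, `|𝐀|, |∇^ξ_U𝐀| ≤ α₂ ≤ 1`, `|∂U − 1| ≤ α₀ξ²`, `α₀ ≤ 1`, `1 ≤ ρ`)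
`‖𝐅(U, 𝐀)(b)‖ ≤ (d − 1)·Cπ·C_F(ρ)·α₂` — every term of 𝐅 carries a factor `|𝐀|` and is uniformly bounded in `ξ` (the second-order term
thanks to the covariant-difference structure, [14] «we use these factors to cancel η⁻¹»); this is the shape `‖𝐅₁‖ ≤ C_F·α₂` that
`B12Membership313J.jArg_norm_lt` takes as a hypothesis for the `𝐉`-slot of (3.13) (there for `𝐅₁ = 𝐅 +` the Landau-gauge lower-order
term, which stays by reference).  §3 **`norm_rem311_le_linear`**: the same on the torus in the letters of `B12RegularSpaces111`
(`plaq`, `nabla`) for `B12Eq311CurrentExpansion.rem311 π ξ U 𝐀` = the remainder of `eq311_current`; `d = Params.d`.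
-/

noncomputable section

open NormedSpace Complex

namespace Literature.MathematicalPhysics.QuantumFieldTheory.Balaban1983to89.B12Eq311RemainderBound

open Literature.MathematicalPhysics.QuantumFieldTheory.Balaban1983to89
open Literature.MathematicalPhysics.QuantumFieldTheory.Balaban1983to89.Beta.TransportVertices
open Literature.MathematicalPhysics.QuantumFieldTheory.Balaban1983to89.Beta.AdjointTransportJets
open Literature.MathematicalPhysics.QuantumFieldTheory.Balaban1983to89.B9Eq37Insertion
open Literature.MathematicalPhysics.QuantumFieldTheory.Balaban1983to89.B9Eq39Adjoint
open Literature.MathematicalPhysics.QuantumFieldTheory.Balaban1983to89.B9Eq369Small Literature.MathematicalPhysics.QuantumFieldTheory.Balaban1983to89.B9Eq369Product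
open Literature.MathematicalPhysics.QuantumFieldTheory.Balaban1983to89.B9Eq370Expansion
open Literature.MathematicalPhysics.QuantumFieldTheory.Balaban1983to89.B9TorusCalculus
open Literature.MathematicalPhysics.QuantumFieldTheory.Balaban1983to89.B12Eq311CurrentExpansion
open Literature.MathematicalPhysics.QuantumFieldTheory.Balaban1983to89.B12Eq311PlaquetteBounds
open Literature.MathematicalPhysics.QuantumFieldTheory.Balaban1983to89.B12Eq311LatticeBounds

/-! ## §1  The bound on `𝐅(U, 𝐀)` -/

section Main

variable {𝔸 : Type*} [NormedRing 𝔸] [NormedAlgebra ℂ 𝔸] [CompleteSpace 𝔸] {S : Type*} {ι : Type*} [Fintype ι] [LinearOrder ι]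
variable (T : ι → Equiv.Perm S) (U : ι → S → 𝔸ˣ)
variable {ρ a g ε ξ Cπ : ℝ} {A : ι → S → 𝔸} {π : 𝔸 →ₗ[ℂ] 𝔸}

/-- **[B12 (3.11), the remainder 𝐅(U, 𝐀) BOUNDED]** («where 𝐅 is a local operator depending on U, ∂U, 𝐀, ∇^ξ_U𝐀 only»), by the
printed route [14] (1.43)–(1.54): for a background with `‖U(b)^{±1}‖ ≤ ρ`, `|𝐀| ≤ a`, `|∇^ξ_U𝐀| ≤ g` (`‖D¹_U𝐀‖ ≤ ξg`),
`|∂U − 1| ≤ ε` everywhere, and a `ℂ`-linear `π` with `‖πX‖ ≤ Cπ‖X‖` commuting with the transports,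
`‖𝐅(U, 𝐀)(b)‖ ≤ (d − 1)·[ξ⁻¹(e^{2ξρ²a} − 1)ρ²·𝔊 + ξ⁻³(B_q + B_r)]` with `𝔊 = Cπ·½(1 + (e^{ξa}ρ)⁴)·(2g + ½s̄²e^{ξs̄} + e^{ξs̄}ε/ξ²)`,
`B_q = Cπξ³(1 + ρ²)(3ρ² + 1)s̄g`, `B_r = (ρ² + 1)Cπ[(ξs̄)³/6·e^{ξs̄} + (e^{ξs̄} − 1)e^{ξs̄}(1 + ρ⁴)ε]`, `s̄ = 2(1 + ρ²)a`,
`d = #directions`. [cite: Balaban1987RG1, (3.11) p.272] -/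
theorem norm_F311_le (hξ : 0 < ξ) (hU : ∀ μ x, ‖(U μ x : 𝔸)‖ ≤ ρ ∧ ‖(((U μ x)⁻¹ : 𝔸ˣ) : 𝔸)‖ ≤ ρ)
    (hA : ∀ μ x, ‖A μ x‖ ≤ a) (hDA : ∀ κ ν y, ‖covD T U κ (A ν) y‖ ≤ ξ * g)
    (hP : ∀ κ ν, κ < ν → ∀ y, ‖(plaqU T U κ ν y : 𝔸) - 1‖ ≤ ε) (hCπ : 0 ≤ Cπ) (hπn : ∀ X, ‖π X‖ ≤ Cπ * ‖X‖)
    (hπR : ∀ μ x X, π (R (U μ x)⁻¹ X) = R (U μ x)⁻¹ (π X)) (μ : ι) (x : S) :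
    ‖F311 T π ξ U A μ x‖
      ≤ (Fintype.card ι - 1) *
        (ξ⁻¹ * ((Real.exp (2 * (ξ * (ρ ^ 2 * a))) - 1) * (ρ ^ 2 *
            (Cπ * ((1 + (Real.exp (ξ * a) * ρ) ^ 4) / 2
              * (2 * g + 1 / 2 * (2 * (1 + ρ ^ 2) * a) ^ 2 * Real.exp (ξ * (2 * (1 + ρ ^ 2) * a))
                + Real.exp (ξ * (2 * (1 + ρ ^ 2) * a)) * (ε / ξ ^ 2))))))
          + (ξ ^ 3)⁻¹ * (Cπ * (ξ ^ 3 * ((1 + ρ ^ 2) * (3 * ρ ^ 2 + 1) * (2 * (1 + ρ ^ 2) * a) * g))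
            + (ρ ^ 2 + 1) * (Cπ * ((ξ * (2 * (1 + ρ ^ 2) * a)) ^ 3 / 6 * Real.exp (ξ * (2 * (1 + ρ ^ 2) * a))
              + (Real.exp (ξ * (2 * (1 + ρ ^ 2) * a)) - 1) * Real.exp (ξ * (2 * (1 + ρ ^ 2) * a)) * (1 + ρ ^ 4) * ε)))) := by
  rw [F311_split T U hξ.ne']
  -- term I
  have hG := norm_Gπ_prodCfg_le T U hξ hU hA hDA hCπ hπn (A := A) (π := π) (ε := ε)
  have hI := norm_divP_sub_divP_le T U (prodCfg U ξ A) (Gπ T π ξ (prodCfg U ξ A)) μ x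
    (fun ν hν => norm_termI_dir_le T U hξ.le hU hA (fun z => hG ν μ z (hP ν μ hν z)) ν x)
    (fun ν hν => norm_termI_dir_le T U hξ.le hU hA (fun z => hG μ ν z (hP μ ν hν z)) ν x)
  -- term q
  have hQ := norm_divP_le T U (qFun T U π ξ A) μ x
    (fun ν _ => norm_covDstar_q₂_le T U hξ.le hU hA hDA hCπ hπn hπR ν ν μ x)
    (fun ν _ => norm_covDstar_q₂_le T U hξ.le hU hA hDA hCπ hπn hπR ν μ ν x)
  -- term r
  have hR := norm_divP_le T U (rFun T U π ξ A) μ x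
    (fun ν hν => norm_covDstar_r₃_le T U hξ.le hU hA hCπ hπn ν ν μ x (hP ν μ hν))
    (fun ν hν => norm_covDstar_r₃_le T U hξ.le hU hA hCπ hπn ν μ ν x (hP μ ν hν))
  refine (norm_add_le _ _).trans ?_
  rw [norm_smul, norm_smul, norm_pow, norm_inv, Complex.norm_real, Real.norm_of_nonneg hξ.le]
  refine (add_le_add (mul_le_mul_of_nonneg_left hI (inv_nonneg.mpr hξ.le))
    (mul_le_mul_of_nonneg_left ((norm_add_le _ _).trans (add_le_add hQ hR)) (pow_nonneg (inv_nonneg.mpr hξ.le) 3))).trans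
    (le_of_eq ?_)
  rw [← inv_pow]
  ring

end Main

/-! ## §2  The linear form in B12 units -/

section Linear

variable {𝔸 : Type*} [NormedRing 𝔸] [NormedAlgebra ℂ 𝔸] [CompleteSpace 𝔸] {S : Type*} {ι : Type*} [Fintype ι] [LinearOrder ι]
variable (T : ι → Equiv.Perm S) (U : ι → S → 𝔸ˣ)
variable {ρ ξ Cπ α₀ α₂ : ℝ} {A : ι → S → 𝔸} {π : 𝔸 →ₗ[ℂ] 𝔸}

omit [Fintype ι] [LinearOrder ι] in
/-- TERM I in B12 units: `≤ Cπ·K_I(ρ)·α₂` ([14] (1.54)'s `O₁(10dα₀α₂…)`, `O₁(36dα₂…|∇A|…)`). [cite: Balaban1985RegularSpaces, (1.54) p.85] -/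
theorem termI_le (hξ : 0 < ξ) (hξ1 : ξ ≤ 1) (hρ : 1 ≤ ρ) (hα₀ : 0 ≤ α₀) (hα₀1 : α₀ ≤ 1) (hα₂ : 0 ≤ α₂) (hα₂1 : α₂ ≤ 1)
    (hCπ : 0 ≤ Cπ) :
    ξ⁻¹ * ((Real.exp (2 * (ξ * (ρ ^ 2 * α₂))) - 1) * (ρ ^ 2 *
        (Cπ * ((1 + (Real.exp (ξ * α₂) * ρ) ^ 4) / 2
          * (2 * α₂ + 1 / 2 * (2 * (1 + ρ ^ 2) * α₂) ^ 2 * Real.exp (ξ * (2 * (1 + ρ ^ 2) * α₂))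
            + Real.exp (ξ * (2 * (1 + ρ ^ 2) * α₂)) * (α₀ * ξ ^ 2 / ξ ^ 2))))))
      ≤ Cπ * KI ρ * α₂ := by
  have exp_sub_one_le_mul_exp : ∀ x : ℝ, Real.exp x - 1 ≤ x * Real.exp x := fun x => by
    have h := Real.add_one_le_exp (-x)
    have hx' : Real.exp (-x) * Real.exp x = 1 := by rw [← Real.exp_add, neg_add_cancel, Real.exp_zero]
    nlinarith [Real.exp_pos x, Real.exp_pos (-x)]
  have hρ0 : 0 ≤ ρ := by linarith
  have hS₀0 : 0 ≤ 2 * (1 + ρ ^ 2) := by positivity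
  have hξα : ξ * α₂ ≤ 1 := by nlinarith
  have hsbS : 2 * (1 + ρ ^ 2) * α₂ ≤ 2 * (1 + ρ ^ 2) := by nlinarith
  have hsb0 : 0 ≤ 2 * (1 + ρ ^ 2) * α₂ := mul_nonneg hS₀0 hα₂
  have hξs : ξ * (2 * (1 + ρ ^ 2) * α₂) ≤ 2 * (1 + ρ ^ 2) := by nlinarith
  have hE1 : Real.exp (ξ * (2 * (1 + ρ ^ 2) * α₂)) ≤ Real.exp (2 * (1 + ρ ^ 2)) := Real.exp_le_exp.mpr hξs
  have hE0 := Real.exp_pos (ξ * (2 * (1 + ρ ^ 2) * α₂))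
  have t1a : ξ⁻¹ * (Real.exp (2 * (ξ * (ρ ^ 2 * α₂))) - 1) ≤ 2 * ρ ^ 2 * α₂ * Real.exp (2 * ρ ^ 2) := by
    have h1 := exp_sub_one_le_mul_exp (2 * (ξ * (ρ ^ 2 * α₂)))
    have h2 : Real.exp (2 * (ξ * (ρ ^ 2 * α₂))) ≤ Real.exp (2 * ρ ^ 2) := by
      refine Real.exp_le_exp.mpr ?_
      calc 2 * (ξ * (ρ ^ 2 * α₂)) = 2 * ρ ^ 2 * (ξ * α₂) := by ring
        _ ≤ 2 * ρ ^ 2 * 1 := mul_le_mul_of_nonneg_left hξα (by positivity)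
        _ = 2 * ρ ^ 2 := by ring
    calc ξ⁻¹ * (Real.exp (2 * (ξ * (ρ ^ 2 * α₂))) - 1) ≤ ξ⁻¹ * (2 * (ξ * (ρ ^ 2 * α₂)) * Real.exp (2 * (ξ * (ρ ^ 2 * α₂)))) :=
          mul_le_mul_of_nonneg_left h1 (inv_nonneg.mpr hξ.le)
      _ = 2 * ρ ^ 2 * α₂ * Real.exp (2 * (ξ * (ρ ^ 2 * α₂))) := by field_simp
      _ ≤ 2 * ρ ^ 2 * α₂ * Real.exp (2 * ρ ^ 2) := mul_le_mul_of_nonneg_left h2 (by positivity)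
  have t1b : (1 + (Real.exp (ξ * α₂) * ρ) ^ 4) / 2 ≤ (1 + Real.exp 4 * ρ ^ 4) / 2 := by
    have e4 : (Real.exp (ξ * α₂) * ρ) ^ 4 = Real.exp (4 * (ξ * α₂)) * ρ ^ 4 := by
      rw [mul_pow, ← Real.exp_nat_mul]; norm_num
    rw [e4]
    have : Real.exp (4 * (ξ * α₂)) ≤ Real.exp 4 := Real.exp_le_exp.mpr (by linarith)
    have : Real.exp (4 * (ξ * α₂)) * ρ ^ 4 ≤ Real.exp 4 * ρ ^ 4 := mul_le_mul_of_nonneg_right this (pow_nonneg hρ0 4)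
    linarith
  have t1c : 2 * α₂ + 1 / 2 * (2 * (1 + ρ ^ 2) * α₂) ^ 2 * Real.exp (ξ * (2 * (1 + ρ ^ 2) * α₂))
        + Real.exp (ξ * (2 * (1 + ρ ^ 2) * α₂)) * (α₀ * ξ ^ 2 / ξ ^ 2)
      ≤ 2 + 1 / 2 * (2 * (1 + ρ ^ 2)) ^ 2 * Real.exp (2 * (1 + ρ ^ 2)) + Real.exp (2 * (1 + ρ ^ 2)) := by
    rw [mul_div_assoc, div_self (pow_ne_zero 2 hξ.ne'), mul_one]
    have h1 : (2 * (1 + ρ ^ 2) * α₂) ^ 2 ≤ (2 * (1 + ρ ^ 2)) ^ 2 := pow_le_pow_left₀ hsb0 hsbS 2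
    have h2 : 1 / 2 * (2 * (1 + ρ ^ 2) * α₂) ^ 2 * Real.exp (ξ * (2 * (1 + ρ ^ 2) * α₂))
        ≤ 1 / 2 * (2 * (1 + ρ ^ 2)) ^ 2 * Real.exp (2 * (1 + ρ ^ 2)) :=
      mul_le_mul (by linarith) hE1 hE0.le (by positivity)
    have h3 : Real.exp (ξ * (2 * (1 + ρ ^ 2) * α₂)) * α₀ ≤ Real.exp (2 * (1 + ρ ^ 2)) := by
      calc Real.exp (ξ * (2 * (1 + ρ ^ 2) * α₂)) * α₀ ≤ Real.exp (2 * (1 + ρ ^ 2)) * 1 :=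
            mul_le_mul hE1 hα₀1 hα₀ (Real.exp_pos _).le
        _ = _ := mul_one _
    linarith
  have hP1 : 0 ≤ 2 * α₂ + 1 / 2 * (2 * (1 + ρ ^ 2) * α₂) ^ 2 * Real.exp (ξ * (2 * (1 + ρ ^ 2) * α₂))
      + Real.exp (ξ * (2 * (1 + ρ ^ 2) * α₂)) * (α₀ * ξ ^ 2 / ξ ^ 2) := by positivity
  have hr1 : 0 ≤ (1 + (Real.exp (ξ * α₂) * ρ) ^ 4) / 2 := by positivity
  calc ξ⁻¹ * ((Real.exp (2 * (ξ * (ρ ^ 2 * α₂))) - 1) * (ρ ^ 2 *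
        (Cπ * ((1 + (Real.exp (ξ * α₂) * ρ) ^ 4) / 2
          * (2 * α₂ + 1 / 2 * (2 * (1 + ρ ^ 2) * α₂) ^ 2 * Real.exp (ξ * (2 * (1 + ρ ^ 2) * α₂))
            + Real.exp (ξ * (2 * (1 + ρ ^ 2) * α₂)) * (α₀ * ξ ^ 2 / ξ ^ 2))))))
      = (ξ⁻¹ * (Real.exp (2 * (ξ * (ρ ^ 2 * α₂))) - 1)) * ρ ^ 2 * Cπ *
          (((1 + (Real.exp (ξ * α₂) * ρ) ^ 4) / 2)
            * (2 * α₂ + 1 / 2 * (2 * (1 + ρ ^ 2) * α₂) ^ 2 * Real.exp (ξ * (2 * (1 + ρ ^ 2) * α₂))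
              + Real.exp (ξ * (2 * (1 + ρ ^ 2) * α₂)) * (α₀ * ξ ^ 2 / ξ ^ 2))) := by ring
    _ ≤ (2 * ρ ^ 2 * α₂ * Real.exp (2 * ρ ^ 2)) * ρ ^ 2 * Cπ *
          (((1 + Real.exp 4 * ρ ^ 4) / 2)
            * (2 + 1 / 2 * (2 * (1 + ρ ^ 2)) ^ 2 * Real.exp (2 * (1 + ρ ^ 2)) + Real.exp (2 * (1 + ρ ^ 2)))) := by
        refine mul_le_mul (mul_le_mul_of_nonneg_right (mul_le_mul_of_nonneg_right t1a (sq_nonneg ρ)) hCπ)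
          (mul_le_mul t1b t1c hP1 (by positivity)) (mul_nonneg hr1 hP1) (by positivity)
    _ = Cπ * KI ρ * α₂ := by rw [KI]; ring

omit [Fintype ι] [LinearOrder ι] in
/-- TERM q in B12 units: `≤ Cπ·K_q(ρ)·α₂` ([14] (1.53)). [cite: Balaban1985RegularSpaces, (1.53) p.85] -/
theorem termQ_le (hξ : 0 < ξ) (hα₂ : 0 ≤ α₂) (hα₂1 : α₂ ≤ 1) (hCπ : 0 ≤ Cπ) :
    (ξ ^ 3)⁻¹ * (Cπ * (ξ ^ 3 * ((1 + ρ ^ 2) * (3 * ρ ^ 2 + 1) * (2 * (1 + ρ ^ 2) * α₂) * α₂)))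
      ≤ Cπ * KQ ρ * α₂ := by
  have e : (ξ ^ 3)⁻¹ * (Cπ * (ξ ^ 3 * ((1 + ρ ^ 2) * (3 * ρ ^ 2 + 1) * (2 * (1 + ρ ^ 2) * α₂) * α₂)))
      = Cπ * (2 * (1 + ρ ^ 2) ^ 2 * (3 * ρ ^ 2 + 1) * α₂) * α₂ := by
    field_simp
  rw [e, KQ]
  refine mul_le_mul_of_nonneg_right (mul_le_mul_of_nonneg_left ?_ hCπ) hα₂
  have h0 : 0 ≤ 2 * (1 + ρ ^ 2) ^ 2 * (3 * ρ ^ 2 + 1) := by positivity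
  calc 2 * (1 + ρ ^ 2) ^ 2 * (3 * ρ ^ 2 + 1) * α₂ ≤ 2 * (1 + ρ ^ 2) ^ 2 * (3 * ρ ^ 2 + 1) * 1 :=
        mul_le_mul_of_nonneg_left hα₂1 h0
    _ = _ := mul_one _

omit [Fintype ι] [LinearOrder ι] in
/-- TERM r in B12 units: `≤ Cπ·K_r(ρ)·α₂` ([14] (1.48), (1.54)'s `O₁(50dα₂³…)`). [cite: Balaban1985RegularSpaces, (1.54) p.85] -/
theorem termR_le (hξ : 0 < ξ) (hξ1 : ξ ≤ 1) (hρ : 1 ≤ ρ) (hα₀ : 0 ≤ α₀) (hα₀1 : α₀ ≤ 1) (hα₂ : 0 ≤ α₂) (hα₂1 : α₂ ≤ 1)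
    (hCπ : 0 ≤ Cπ) :
    (ξ ^ 3)⁻¹ * ((ρ ^ 2 + 1) * (Cπ * ((ξ * (2 * (1 + ρ ^ 2) * α₂)) ^ 3 / 6 * Real.exp (ξ * (2 * (1 + ρ ^ 2) * α₂))
        + (Real.exp (ξ * (2 * (1 + ρ ^ 2) * α₂)) - 1) * Real.exp (ξ * (2 * (1 + ρ ^ 2) * α₂)) * (1 + ρ ^ 4) * (α₀ * ξ ^ 2))))
      ≤ Cπ * KR ρ * α₂ := by
  have exp_sub_one_le_mul_exp : ∀ x : ℝ, Real.exp x - 1 ≤ x * Real.exp x := fun x => by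
    have h := Real.add_one_le_exp (-x)
    have hx' : Real.exp (-x) * Real.exp x = 1 := by rw [← Real.exp_add, neg_add_cancel, Real.exp_zero]
    nlinarith [Real.exp_pos x, Real.exp_pos (-x)]
  have hρ0 : 0 ≤ ρ := by linarith
  have hS₀0 : 0 ≤ 2 * (1 + ρ ^ 2) := by positivity
  have hsbS : 2 * (1 + ρ ^ 2) * α₂ ≤ 2 * (1 + ρ ^ 2) := by nlinarith
  have hsb0 : 0 ≤ 2 * (1 + ρ ^ 2) * α₂ := mul_nonneg hS₀0 hα₂
  have hξs : ξ * (2 * (1 + ρ ^ 2) * α₂) ≤ 2 * (1 + ρ ^ 2) := by nlinarith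
  have hξs0 : 0 ≤ ξ * (2 * (1 + ρ ^ 2) * α₂) := by positivity
  have hE1 : Real.exp (ξ * (2 * (1 + ρ ^ 2) * α₂)) ≤ Real.exp (2 * (1 + ρ ^ 2)) := Real.exp_le_exp.mpr hξs
  have hE1' : 1 ≤ Real.exp (ξ * (2 * (1 + ρ ^ 2) * α₂)) := Real.one_le_exp hξs0
  have hE0 := Real.exp_pos (ξ * (2 * (1 + ρ ^ 2) * α₂))
  have t3a : (ξ * (2 * (1 + ρ ^ 2) * α₂)) ^ 3 / 6 * Real.exp (ξ * (2 * (1 + ρ ^ 2) * α₂))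
      ≤ ξ ^ 3 * ((2 * (1 + ρ ^ 2)) ^ 2 / 6 * Real.exp (2 * (1 + ρ ^ 2)) * (2 * (1 + ρ ^ 2) * α₂)) := by
    have h1 : (2 * (1 + ρ ^ 2) * α₂) ^ 3 ≤ (2 * (1 + ρ ^ 2)) ^ 2 * (2 * (1 + ρ ^ 2) * α₂) := by
      rw [pow_succ]; exact mul_le_mul_of_nonneg_right (pow_le_pow_left₀ hsb0 hsbS 2) hsb0
    calc (ξ * (2 * (1 + ρ ^ 2) * α₂)) ^ 3 / 6 * Real.exp (ξ * (2 * (1 + ρ ^ 2) * α₂))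
        = ξ ^ 3 * ((2 * (1 + ρ ^ 2) * α₂) ^ 3 / 6 * Real.exp (ξ * (2 * (1 + ρ ^ 2) * α₂))) := by ring
      _ ≤ ξ ^ 3 * ((2 * (1 + ρ ^ 2)) ^ 2 * (2 * (1 + ρ ^ 2) * α₂) / 6 * Real.exp (2 * (1 + ρ ^ 2))) := by
          refine mul_le_mul_of_nonneg_left (mul_le_mul (by linarith) hE1 hE0.le (by positivity)) (pow_nonneg hξ.le 3)
      _ = ξ ^ 3 * ((2 * (1 + ρ ^ 2)) ^ 2 / 6 * Real.exp (2 * (1 + ρ ^ 2)) * (2 * (1 + ρ ^ 2) * α₂)) := by ring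
  have t3b : (Real.exp (ξ * (2 * (1 + ρ ^ 2) * α₂)) - 1) * Real.exp (ξ * (2 * (1 + ρ ^ 2) * α₂)) * (1 + ρ ^ 4) * (α₀ * ξ ^ 2)
      ≤ ξ ^ 3 * (Real.exp (2 * (2 * (1 + ρ ^ 2))) * (1 + ρ ^ 4) * (2 * (1 + ρ ^ 2) * α₂)) := by
    have h1 : Real.exp (ξ * (2 * (1 + ρ ^ 2) * α₂)) - 1
        ≤ ξ * (2 * (1 + ρ ^ 2) * α₂) * Real.exp (ξ * (2 * (1 + ρ ^ 2) * α₂)) := exp_sub_one_le_mul_exp _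
    have h2 : Real.exp (ξ * (2 * (1 + ρ ^ 2) * α₂)) * Real.exp (ξ * (2 * (1 + ρ ^ 2) * α₂)) ≤ Real.exp (2 * (2 * (1 + ρ ^ 2))) := by
      rw [← Real.exp_add]; exact Real.exp_le_exp.mpr (by linarith)
    have h1' : 0 ≤ Real.exp (ξ * (2 * (1 + ρ ^ 2) * α₂)) - 1 := by linarith
    calc (Real.exp (ξ * (2 * (1 + ρ ^ 2) * α₂)) - 1) * Real.exp (ξ * (2 * (1 + ρ ^ 2) * α₂)) * (1 + ρ ^ 4) * (α₀ * ξ ^ 2)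
        ≤ (ξ * (2 * (1 + ρ ^ 2) * α₂) * Real.exp (ξ * (2 * (1 + ρ ^ 2) * α₂))) * Real.exp (ξ * (2 * (1 + ρ ^ 2) * α₂))
            * (1 + ρ ^ 4) * (1 * ξ ^ 2) := by
          gcongr
      _ = ξ ^ 3 * ((Real.exp (ξ * (2 * (1 + ρ ^ 2) * α₂)) * Real.exp (ξ * (2 * (1 + ρ ^ 2) * α₂))) * (1 + ρ ^ 4)
            * (2 * (1 + ρ ^ 2) * α₂)) := by ring
      _ ≤ ξ ^ 3 * (Real.exp (2 * (2 * (1 + ρ ^ 2))) * (1 + ρ ^ 4) * (2 * (1 + ρ ^ 2) * α₂)) := by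
          refine mul_le_mul_of_nonneg_left ?_ (pow_nonneg hξ.le 3)
          gcongr
  have hsum := add_le_add t3a t3b
  calc (ξ ^ 3)⁻¹ * ((ρ ^ 2 + 1) * (Cπ * ((ξ * (2 * (1 + ρ ^ 2) * α₂)) ^ 3 / 6 * Real.exp (ξ * (2 * (1 + ρ ^ 2) * α₂))
        + (Real.exp (ξ * (2 * (1 + ρ ^ 2) * α₂)) - 1) * Real.exp (ξ * (2 * (1 + ρ ^ 2) * α₂)) * (1 + ρ ^ 4) * (α₀ * ξ ^ 2))))
      ≤ (ξ ^ 3)⁻¹ * ((ρ ^ 2 + 1) * (Cπ * (ξ ^ 3 * ((2 * (1 + ρ ^ 2)) ^ 2 / 6 * Real.exp (2 * (1 + ρ ^ 2)) * (2 * (1 + ρ ^ 2) * α₂))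
          + ξ ^ 3 * (Real.exp (2 * (2 * (1 + ρ ^ 2))) * (1 + ρ ^ 4) * (2 * (1 + ρ ^ 2) * α₂))))) := by
        refine mul_le_mul_of_nonneg_left (mul_le_mul_of_nonneg_left (mul_le_mul_of_nonneg_left hsum hCπ) (by positivity))
          (inv_nonneg.mpr (pow_nonneg hξ.le 3))
    _ = Cπ * KR ρ * α₂ := by
        rw [KR]
        field_simp
        ring

/-- **[B12 (3.11)] THE LINEAR BOUND `‖𝐅(U, 𝐀)‖ ≤ C_F·α₂`** — the shape «from the form of the expressions» used on p. 272 for the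
`𝐉`-slot of (3.13) (`B12Membership313J.jArg_norm_lt`'s hypothesis `‖𝐅₁‖ ≤ C_F·α₂`, there a binder): in B12 units `0 < ξ ≤ 1`,
`|𝐀| ≤ α₂`, `|∇^ξ_U𝐀| ≤ α₂` (`‖D¹_U𝐀‖ ≤ ξα₂`), `|∂U − 1| ≤ α₀ξ²` on the positively oriented plaquettes, `α₀, α₂ ≤ 1`,
`‖U(b)^{±1}‖ ≤ ρ` (`1 ≤ ρ`), `‖πX‖ ≤ Cπ‖X‖`, `π` commuting with the transports:
`‖𝐅(U, 𝐀)(b)‖ ≤ (d − 1)·Cπ·C_F(ρ)·α₂`. [cite: Balaban1987RG1, (3.11)–(3.14) p.272] -/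
theorem norm_F311_le_linear (hξ : 0 < ξ) (hξ1 : ξ ≤ 1) (hρ : 1 ≤ ρ)
    (hU : ∀ μ x, ‖(U μ x : 𝔸)‖ ≤ ρ ∧ ‖(((U μ x)⁻¹ : 𝔸ˣ) : 𝔸)‖ ≤ ρ)
    (hα₀ : 0 ≤ α₀) (hα₀1 : α₀ ≤ 1) (hα₂1 : α₂ ≤ 1)
    (hA : ∀ μ x, ‖A μ x‖ ≤ α₂) (hDA : ∀ κ ν y, ‖covD T U κ (A ν) y‖ ≤ ξ * α₂)
    (hP : ∀ κ ν, κ < ν → ∀ y, ‖(plaqU T U κ ν y : 𝔸) - 1‖ ≤ α₀ * ξ ^ 2) (hCπ : 0 ≤ Cπ)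
    (hπn : ∀ X, ‖π X‖ ≤ Cπ * ‖X‖) (hπR : ∀ μ x X, π (R (U μ x)⁻¹ X) = R (U μ x)⁻¹ (π X)) (μ : ι) (x : S) :
    ‖F311 T π ξ U A μ x‖ ≤ (Fintype.card ι - 1) * (Cπ * C311 ρ * α₂) := by
  have hα₂ : 0 ≤ α₂ := (norm_nonneg _).trans (hA μ x)
  have main := norm_F311_le T U hξ hU hA hDA hP hCπ hπn hπR μ x (ε := α₀ * ξ ^ 2)
  refine main.trans (mul_le_mul_of_nonneg_left ?_ ?_)
  · rw [mul_add (ξ ^ 3)⁻¹, C311,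
      show Cπ * (KI ρ + KQ ρ + KR ρ) * α₂ = Cπ * KI ρ * α₂ + (Cπ * KQ ρ * α₂ + Cπ * KR ρ * α₂) by ring]
    exact add_le_add (termI_le hξ hξ1 hρ hα₀ hα₀1 hα₂ hα₂1 hCπ)
      (add_le_add (termQ_le (ρ := ρ) hξ hα₂ hα₂1 hCπ) (termR_le hξ hξ1 hρ hα₀ hα₀1 hα₂ hα₂1 hCπ))
  · have : (1 : ℝ) ≤ Fintype.card ι := by
      have : 0 < Fintype.card ι := Fintype.card_pos_iff.mpr ⟨μ⟩
      exact_mod_cast this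
    linarith

end Linear

/-! ## §3  On the torus, in the letters of the spaces (1.11)–(1.14) -/

section Torus

variable {P : Params} {i : ℕ} {𝔸 : Type*} [NormedRing 𝔸] [NormedAlgebra ℂ 𝔸] [CompleteSpace 𝔸]

/-- **[B12 (3.11)–(3.14)] «𝐅 is a local operator depending on U, ∂U, 𝐀, ∇^ξ_U𝐀 only» — THE BOUND, in the letters of the
spaces (1.11)–(1.14)**: for `0 < ξ ≤ 1`, bond variables with `‖U(b)^{±1}‖ ≤ ρ` (`1 ≤ ρ`), `|𝐀| ≤ α₂`, `|∇^ξ_U𝐀| ≤ α₂`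
(`B12RegularSpaces111.nabla`), `|∂U − 1| ≤ α₀ξ²` on the plaquettes (`B12RegularSpaces111.plaq`), `α₀, α₂ ≤ 1`, and `π` with
`‖πX‖ ≤ Cπ‖X‖` commuting with the transports `Ad(U(b)⁻¹)`: `‖𝐅(U, 𝐀)(b)‖ ≤ (d − 1)·Cπ·C_F(ρ)·α₂` at every bond — the shape
`‖𝐅₁‖ ≤ C_F·α₂` consumed by `B12Membership313J.jArg_norm_lt` for the `𝐉`-slot of (3.13). [cite: Balaban1987RG1, (3.11)–(3.14) p.272] -/
theorem norm_rem311_le_linear {ρ ξ Cπ α₀ α₂ : ℝ} {π : 𝔸 →ₗ[ℂ] 𝔸} {U : PBond P i → 𝔸ˣ} {A : PBond P i → 𝔸}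
    (hξ : 0 < ξ) (hξ1 : ξ ≤ 1) (hρ : 1 ≤ ρ) (hU : ∀ b, ‖(U b : 𝔸)‖ ≤ ρ ∧ ‖(((U b)⁻¹ : 𝔸ˣ) : 𝔸)‖ ≤ ρ)
    (hα₀ : 0 ≤ α₀) (hα₀1 : α₀ ≤ 1) (hα₂1 : α₂ ≤ 1) (hA : ∀ b, ‖A b‖ ≤ α₂)
    (hDA : ∀ μ ν x, ‖B12RegularSpaces111.nabla ξ U μ (fun y => A ⟨y, ν⟩) x‖ ≤ α₂)
    (hP : ∀ p : Plaq P i, ‖((B12RegularSpaces111.plaq U p : 𝔸ˣ) : 𝔸) - 1‖ ≤ α₀ * ξ ^ 2) (hCπ : 0 ≤ Cπ)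
    (hπn : ∀ X, ‖π X‖ ≤ Cπ * ‖X‖) (hπR : ∀ b X, π (R (U b)⁻¹ X) = R (U b)⁻¹ (π X)) (b : PBond P i) :
    ‖rem311 π ξ U A b‖ ≤ (P.d - 1) * (Cπ * C311 ρ * α₂) := by
  have h := norm_F311_le_linear (torusT P i) (B12Eq18Current.dirForm U) (A := B12Eq18Current.dirForm A) (π := π)
    hξ hξ1 hρ (fun μ x => hU ⟨x, μ⟩) hα₀ hα₀1 hα₂1 (fun μ x => hA ⟨x, μ⟩)
    (fun κ ν y => (norm_eta_inv_smul_le_iff hξ _).mp (by rw [← nabla_eq_smul_covD]; exact hDA κ ν y))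
    (fun κ ν hκν y => by rw [← B12Eq18Current.plaq_eq_plaqU U ⟨y, κ, ν, hκν⟩]; exact hP _) hCπ hπn
    (fun μ x X => hπR ⟨x, μ⟩ X) b.dir b.src
  rw [Fintype.card_fin] at h
  exact h

end Torus

end Literature.MathematicalPhysics.QuantumFieldTheory.Balaban1983to89.B12Eq311RemainderBound
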